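import Literature.Computability.Cryptography.BLPRSSection4AssemblyApprox
import Literature.Computability.Cryptography.LWEShiftDimProg
import Literature.Computability.Cryptography.LWEHybridT2Law
import HarnessLib

/-!
# The machine's candidate `Ẽ₂` at the level of laws: residues and samplers instead of exact coins, and its distance to `candE₂`

Topic `Computability/Cryptography` (LWE), grouping namespace `BLPRS2013`; law-level companion of the forthcoming program file composing the transformations of
`LWEShiftDimProg.lean` (`machDimExt`, `machShift`) and `LWEHybridT2Law.lean` (`machHybT2`) with a test `A'`. The explicit candidate of
`BLPRSSection4AssemblyExplicit.lean` is `candE₂ χN M A' = dimExtendThen 0 (shiftThen M (hybridB₂ χN M A'))`, i.e. `S ↦ dimExtend 0 ≫= secretShift ≫= hybridT₂ χN ≫= A'`;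
the machine replaces each exact-coin stage by its residue/sampler version. This file defines that composition and bounds the change of every acceptance probability —
the `ν_E` of `BLPRSSection4AssemblyApprox.section4_selected_explicit_close` for candidate `2` (everything PROVED; one definition with body; no named fact):

* `tvDist_bind_bind_le` (`Δ(μ ≫= f, ν ≫= g) ≤ Δ(μ, ν) + sup Δ(f x, g x)`), `candE₂_apply` (the exact chain, unfolded);
* `machE₂ L θ s N P w R M A'` (the machine's chain), **`tvDist_machE₂_candE₂_le`** (per input tuple) and **`abs_acceptProb_machE₂_sub_le`** (per input law):
  `≤ M·Q/2ᴸ + ((d+1)·Q/2ᴸ + (n·((d+1)·Q/2ᴸ) + M·(n·Δ_rej)))`.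

## References

* Z. Brakerski, A. Langlois, C. Peikert, O. Regev, D. Stehlé, *Classical hardness of learning with errors*, STOC 2013; arXiv:1306.0281, Thm. 4.1 (proof), Lemma 4.9
  (proof, `ℬ₂`) and §5 ("sampled efficiently up to negligible statistical distance"). [BrakerskiEtAl2013]
* O. Goldreich, *Foundations of Cryptography I*, CUP 2001, §3.2.1–§3.2.3. [Goldreich2001]
-/

noncomputable section

open scoped ENNReal
open PMF Literature.Probability.Distributions Literature.Algebra.EuclideanLattices

namespace Literature.Computability.Cryptography

namespace BLPRS2013

open LWE KProg

/-- **Two-stage processing with close stages**: `Δ(μ ≫= f, ν ≫= g) ≤ Δ(μ, ν) + δ` when `Δ(f x, g x) ≤ δ` for all `x`. [cite: Goldreich2001, §3.2.1] -/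
theorem tvDist_bind_bind_le {α β : Type} (μ ν : PMF α) (f g : α → PMF β) {δ : ℝ} (h : ∀ x, (f x).tvDist (g x) ≤ δ) :
    (μ.bind f).tvDist (ν.bind g) ≤ μ.tvDist ν + δ :=
  (PMF.tvDist_triangle_holds _ (ν.bind f) _).trans (add_le_add (tvDist_bind_left_le μ ν f) (PMF.tvDist_bind_le_of_forall_le ν f g h))

section E2

variable {n d Q : ℕ} [NeZero Q] (χN : PMF (Fin n → ℤ)) (L : ℕ) (θ : ℚ) (s N P w R M : ℕ) (A' : Distinguisher (Fin n) (ZMod Q) M)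

/-- **The exact chain of candidate 2, unfolded**: `dimExtend 0 ≫= secretShift ≫= hybridT₂ χN ≫= A'`. [cite: BrakerskiEtAl2013, Thm. 4.1 (proof)] -/
theorem candE₂_apply (S : Fin M → (Fin d → ZMod Q) × ZMod Q) :
    candE₂ (k := d) χN M A' S = (dimExtend (0 : ZMod Q) M S).bind fun S₁ => (secretShift M S₁).bind fun S₂ => (hybridT₂ χN M S₂).bind A' := rfl

/-- **The machine's candidate 2**: the same chain with residues for the fresh coordinates, the shift and the matrix, and the rejection sampler for the lattice noise.
[cite: BrakerskiEtAl2013, Thm. 4.1 (proof), Lemma 4.9 (proof, ℬ₂) and §5] -/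
def machE₂ : Distinguisher (Fin d) (ZMod Q) M :=
  fun S => (machDimExt L M S).bind fun S₁ => (machShift L M S₁).bind fun S₂ => (machHybT2 (n := n) L θ s N P w R M S₂).bind A'

/-- **Per input tuple, the machine's chain is close to the exact one** (when `χN` is the iid discrete Gaussian the sampler targets).
[cite: BrakerskiEtAl2013, §5; Goldreich2001, §3.2.1] -/
theorem tvDist_machE₂_candE₂_le (hχ : χN = iidPMF (discreteGaussianInt (Real.sqrt (Real.pi / θ)) 0) n) (S : Fin M → (Fin d → ZMod Q) × ZMod Q) :
    (machE₂ (n := n) L θ s N P w R M A' S).tvDist (candE₂ (k := d) χN M A' S) ≤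
      M * ((Q : ℝ) / 2 ^ L) + ((d + 1) * ((Q : ℝ) / 2 ^ L) +
        (n * ((d + 1) * ((Q : ℝ) / 2 ^ L)) + M * (n * (GaussRej.rejLaw θ 0 s N P w R).tvDist (discreteGaussianInt (Real.sqrt (Real.pi / θ)) 0)))) := by
  rw [candE₂_apply]
  unfold machE₂
  refine tvDist_bind_bind_le _ _ _ _ (fun S₁ => ?_) |>.trans (add_le_add (tvDist_machDimExt_le L M S) le_rfl)
  refine tvDist_bind_bind_le _ _ _ _ (fun S₂ => ?_) |>.trans (add_le_add ?_ le_rfl)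
  · refine (tvDist_bind_left_le _ _ _).trans ?_
    have h := tvDist_machHybT2_hybridT₂_le (k := d + 1) (Q := Q) L θ s N P w R M S₂ hχ
    push_cast at h ⊢
    exact h
  · have h := tvDist_machShift_le (Q := Q) (n := d + 1) L M S₁
    push_cast at h ⊢
    exact h

/-- **Per input law, the acceptance probabilities of `Ẽ₂` and `candE₂` differ by at most the same bound.** [cite: Goldreich2001, §3.2.1] -/
theorem abs_acceptProb_machE₂_sub_le (hχ : χN = iidPMF (discreteGaussianInt (Real.sqrt (Real.pi / θ)) 0) n) (Pin : PMF (Fin M → (Fin d → ZMod Q) × ZMod Q)) :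
    |(acceptProb (machE₂ (n := n) L θ s N P w R M A') Pin).toReal - (acceptProb (candE₂ (k := d) χN M A') Pin).toReal| ≤
      M * ((Q : ℝ) / 2 ^ L) + ((d + 1) * ((Q : ℝ) / 2 ^ L) +
        (n * ((d + 1) * ((Q : ℝ) / 2 ^ L)) + M * (n * (GaussRej.rejLaw θ 0 s N P w R).tvDist (discreteGaussianInt (Real.sqrt (Real.pi / θ)) 0)))) := by
  unfold acceptProb
  rw [← PMF.toOuterMeasure_apply_singleton (Pin.bind _) true, ← PMF.toOuterMeasure_apply_singleton (Pin.bind (candE₂ (k := d) χN M A')) true]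
  refine (PMF.abs_toReal_toOuterMeasure_sub_le_tvDist _ _ {true}).trans ?_
  exact PMF.tvDist_bind_le_of_forall_le Pin _ _ fun S => tvDist_machE₂_candE₂_le χN L θ s N P w R M A' hχ S

end E2

end BLPRS2013

end Literature.Computability.Cryptography

end
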